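import Literature.NumberTheory.EllipticCurves.Kato2004.IwasawaH1ReductionKernel
import Literature.NumberTheory.EllipticCurves.GaloisActionProofs
import Literature.NumberTheory.GaloisRepresentations.ContinuousCorestrictionComp
import Literature.NumberTheory.GaloisRepresentations.AbsGaloisOuterConj
import Literature.NumberTheory.GaloisRepresentations.AbsIntegersEquiv
import Literature.NumberTheory.GaloisRepresentations.CyclotomicCharacterFrobeniusProofs
import Literature.NumberTheory.GaloisRepresentations.IntegralGaloisActionProofs
import HarnessLib

/-!
# Kato 2004 (Astérisque 295) Lemma 8.5 (2), tools III: the layers of the cyclotomic tower —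
# class-level transport along corestriction, Frobenius generators, iterated trace maps

Topic `NumberTheory/EllipticCurves`, sub-directory `Kato2004` (namespace = path, sub-namespace
`UniversalNorms`).  Cell `bsd-smallim` (rung K6 of `BirchSwinnertonDyer`), seat `bsd-smallim-k6-lur-a`
(gen 3).  THEOREMS ONLY (no definition, no named fact, no `sorry`).  Third file towards the discharge of
the named fact `Kato2004.mem_integralH1_of_forall_layerCores_eq` (Kato's Lemma 8.5 (2) on the pin, strong
form).  The three statements below are the layer bookkeeping of the proof; they are MOVED VERBATIM (same
seat lineage, gen 2, proposals p479214 / p479589) from the `Summits` files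
`Theorems/SmallImageMuTransferMuTransferX9UniversalNormsTools.lean` (§2, §4) and
`Theorems/SmallImageMuTransferMuTransferX9NormCompatibleIntegral.lean` (§6), where they served the WEAK
form (director-approved re-home of the `UniversalNorms` material under `Literature/…/Kato2004/`,
pub/bsd-smallim INBOX 2026-08-27T01:07:55Z (4)); the `Summits` copies become redundant.

* §1 `resLe_coresLe_eq_zero_of_forall_primesAbove` — `cor_{V → U}` (`V ⊴ Γ_ℚ` open in `U`,
  `U ∩ I_𝔓 ⊆ V` for `𝔓 ∣ v`) preserves "the restriction to `Γ ∩ I_𝔓'` vanishes for EVERY `𝔓' ∣ v`" at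
  CLASS level (NSW (1.5.7), normal case of the double coset formula, on cocycles).
* §2 `exists_generator` — for the CYCLOTOMIC `κ` and `v ≠ p` there is a layer `n₀` above which every
  prime over `v` is inert: for `n' ≥ n₀`, `k`, `𝔓 ∣ v` some `φ ∈ D_𝔓 ∩ Γ_{n'}` generates `Γ_{n'}/Γ_{n'+k}`
  (`χ_p(Frob) = N v` has infinite order, `ker κ = χ_p⁻¹(torsion)`; `n₀ = v_p(κ(Frob))`).
* §3 `finiteIndex_layerSubgroup`, `eq_coresLe_add_succ` — `z_n = cor_{Γ_{n+d+1} → Γ_n} z_{n+d+1}` for a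
  norm-compatible family (transitivity of corestriction).

References: K. Kato, Astérisque 295 (2004), §8.2, Lemma 8.5 (pp. 180–184), §12.2 (p. 220)
[Kato2004Asterisque]; J. Neukirch, A. Schmidt, K. Wingberg, *Cohomology of Number Fields* (2008), I §5
(1.5.6)–(1.5.7), Prop. 1.5.3 [NeukirchSchmidtWingberg2008]; L. Washington, *Introduction to Cyclotomic
Fields* (1997), §13.1, Prop. 13.2 [Washington1997]; J.-P. Serre, *Abelian ℓ-adic representations and
elliptic curves* (1968), Ch. I §1.2 [SerreAbelianLadic1968].
-/

noncomputable section

open scoped NumberField Pointwise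
open CategoryTheory Field IsDedekindDomain
open Literature.NumberTheory.GaloisRepresentations
open Literature.NumberTheory.EllipticCurves
open Literature.NumberTheory.EllipticCurves.ZpExtension
open Literature.NumberTheory.EllipticCurves.Kato2004
open Literature.NumberTheory.EllipticCurves.Kato2004.EulerSystemValues
open Rat.HeightOneSpectrum

namespace Literature.NumberTheory.EllipticCurves.Kato2004.UniversalNorms

/-! ## §1 Relative corestriction preserves "unramified at `v`" at CLASS level (per place) -/

section CoresPlace

variable {A : Type} [CommRing A] [TopologicalSpace A]
variable {M : Type} [AddCommGroup M] [Module A M] [TopologicalSpace M] [IsTopologicalAddGroup M]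
  [ContinuousSMul A M]

/-- For `V` normal, elements of `V` act trivially on `U/V` (copy of the private lemma of
`Kato2004/IntegralH1Corestriction`). [cite: NeukirchSchmidtWingberg2008, I §5 (1.5.7)] -/
private theorem smul_eq_self_of_mem' {G : Type*} [Group G] {N U : Subgroup G} [N.Normal] {n : U}
    (hn : (n : G) ∈ N) (x : U ⧸ N.subgroupOf U) : n • x = x := by
  induction x using QuotientGroup.induction_on with
  | H u =>
    rw [MulAction.Quotient.smul_mk, QuotientGroup.eq, Subgroup.mem_subgroupOf, smul_eq_mul]
    have : (((n * u)⁻¹ * u : U) : G) = (u : G)⁻¹ * (n : G)⁻¹ * ((u : G)⁻¹)⁻¹ := by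
      push_cast; group
    rw [this]
    exact Subgroup.Normal.conj_mem inferInstance _ (N.inv_mem hn) _

open Literature.NumberTheory.EllipticCurves (schreierElt schreierElt_mem schreierElt_coe
  rep_mul_schreierElt subgroupInclusion subgroupInclusion_apply_coe) in
/-- **`cor_{V → U}` preserves the classes unramified at `v`, per place, at CLASS level.**  Let
`V ⊴ Γ_ℚ` be open of finite index in `U ≥ V`, with `U ∩ I_𝔓 ⊆ V` for every `𝔓 ∣ v`.  If
`res_{V ∩ I_𝔓'} x = 0` for EVERY `𝔓' ∣ v`, then `res_{U ∩ I_𝔓} (cor x) = 0` for every `𝔓 ∣ v`: on cocycles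
`(cor_s φ)(g) = Σ_x s(x)·φ(s(x)⁻¹ g s(x))` for `g ∈ U ∩ I_𝔓` (trivial on `U/V`), each `φ|_{V ∩ I_{s(x)⁻¹𝔓}}`
is a coboundary `∂w_x`, whence `cor_s φ|_{U ∩ I_𝔓} = ∂(Σ_x s(x)·w_x)` (per-place form of the tree's
`TameClass.coresLe_mem_integralH1_of_inertia_le`). [cite: Kato2004Asterisque, §8.2 and Lemma 8.5 (pp. 180–184)]
[cite: NeukirchSchmidtWingberg2008, I §5 (1.5.7)] -/
theorem resLe_coresLe_eq_zero_of_forall_primesAbove (T : GaloisRep ℚ A M)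
    {V U : Subgroup (absoluteGaloisGroup ℚ)} [V.Normal] (h : V ≤ U)
    (hV : IsOpen (V : Set (absoluteGaloisGroup ℚ))) [Fintype (U ⧸ V.subgroupOf U)]
    {v : HeightOneSpectrum (𝓞 ℚ)}
    (hunr : ∀ 𝔓 ∈ v.primesAbove, ∀ g ∈ U, g ∈ 𝔓.inertia (absoluteGaloisGroup ℚ) → g ∈ V)
    {x : H1 T V}
    (hx : ∀ 𝔓 ∈ v.primesAbove,
      resLe T.toTopRep (inf_le_left : V ⊓ 𝔓.inertia (absoluteGaloisGroup ℚ) ≤ V) 1 x = 0)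
    {𝔓 : Ideal (absIntegers (𝓞 ℚ) ℚ)} (h𝔓 : 𝔓 ∈ v.primesAbove) :
    resLe T.toTopRep (inf_le_left : U ⊓ 𝔓.inertia (absoluteGaloisGroup ℚ) ≤ U) 1
      (coresLe T.toTopRep h hV x) = 0 := by
  obtain ⟨φ, rfl⟩ := oneCocycleClass_surjective _ x
  -- representatives of `U/V`
  have hs : ∀ y : U ⧸ V.subgroupOf U, ((Quotient.out y : U) : U ⧸ V.subgroupOf U) = y :=
    fun y ↦ QuotientGroup.out_eq' y
  -- `φ` is a coboundary on `V ∩ I_{𝔓'}` for every `𝔓' ∣ v`: choose the witnesses at the conjugates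
  have hcob : ∀ y : U ⧸ V.subgroupOf U, ∃ w : M,
      ∀ g : ↥(V ⊓ ((((Quotient.out y : U) : absoluteGaloisGroup ℚ)⁻¹ • 𝔓).inertia
        (absoluteGaloisGroup ℚ))),
      φ.1 (subgroupInclusion inf_le_left g) = T.toTopRep.ρ (g : absoluteGaloisGroup ℚ) w - w := by
    intro y
    have h0 := hx _ (smul_mem_primesAbove h𝔓 ((Quotient.out y : U) : absoluteGaloisGroup ℚ)⁻¹)
    rw [resLe_oneCocycleClass, oneCocycleClass_eq_zero_iff] at h0
    obtain ⟨w, hw⟩ := h0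
    exact ⟨w, fun g ↦ hw g⟩
  choose w hw using hcob
  rw [coresLe_oneCocycleClass T.toTopRep h hV hs φ, resLe_oneCocycleClass, oneCocycleClass_eq_zero_iff]
  refine ⟨∑ y, T.toTopRep.ρ ((Quotient.out y : U) : absoluteGaloisGroup ℚ) (w y), fun g ↦ ?_⟩
  -- `g ∈ U ∩ I_𝔓`, hence `g ∈ V` and it acts trivially on `U/V`
  have hgI : (g : absoluteGaloisGroup ℚ) ∈ 𝔓.inertia (absoluteGaloisGroup ℚ) := g.2.2
  have hgV : (g : absoluteGaloisGroup ℚ) ∈ V := hunr 𝔓 h𝔓 _ g.2.1 hgI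
  rw [contOneCocycles.pullback_apply, TopRep.hom_ofHom]
  change (transferCocycle (subgroupRep T.toTopRep U) (V.subgroupOf U) (isOpen_subgroupOf U hV) hs
      (contOneCocycles.pullback (subgroupOfHom h)
        (Y := subgroupRep (subgroupRep T.toTopRep U) (V.subgroupOf U))
        (TopRep.ofHom ⟨ContinuousLinearMap.id A M, fun _ => rfl⟩) φ)).1
      (subgroupInclusion (inf_le_left : U ⊓ 𝔓.inertia (absoluteGaloisGroup ℚ) ≤ U) g) = _
  rw [transferCocycle_pullback_apply T.toTopRep h hV hs, map_sum, ← Finset.sum_sub_distrib]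
  refine Finset.sum_congr rfl fun y _ ↦ ?_
  have hgy : subgroupInclusion (inf_le_left : U ⊓ 𝔓.inertia (absoluteGaloisGroup ℚ) ≤ U) g • y = y :=
    smul_eq_self_of_mem' (by simpa [subgroupInclusion_apply_coe] using hgV) y
  -- the Schreier element `s(y)⁻¹ g s(y)` lies in `V ∩ I_{s(y)⁻¹ 𝔓}`
  set σ : absoluteGaloisGroup ℚ := ((Quotient.out y : U) : absoluteGaloisGroup ℚ) with hσ
  have hmemI : σ⁻¹ * (g : absoluteGaloisGroup ℚ) * σ ∈ (σ⁻¹ • 𝔓).inertia (absoluteGaloisGroup ℚ) := by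
    have := (Ideal.conj_mem_inertia_smul_iff 𝔓 σ⁻¹ (g : absoluteGaloisGroup ℚ)).mpr hgI
    simpa using this
  have hmemV : σ⁻¹ * (g : absoluteGaloisGroup ℚ) * σ ∈ V :=
    Subgroup.Normal.conj_mem' inferInstance _ hgV σ
  have key := hw y ⟨σ⁻¹ * (g : absoluteGaloisGroup ℚ) * σ, hmemV, hmemI⟩
  have harg : subgroupOfHom h (schreierElt (V.subgroupOf U) hs
        (subgroupInclusion (inf_le_left : U ⊓ 𝔓.inertia (absoluteGaloisGroup ℚ) ≤ U) g) y) =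
      subgroupInclusion inf_le_left ⟨σ⁻¹ * (g : absoluteGaloisGroup ℚ) * σ, hmemV, hmemI⟩ := by
    apply Subtype.ext
    rw [subgroupOfHom_apply_coe, schreierElt_coe, hgy, subgroupInclusion_apply_coe]
    simp [hσ, subgroupInclusion_apply_coe]
  have key' : φ.1 (subgroupInclusion inf_le_left ⟨σ⁻¹ * (g : absoluteGaloisGroup ℚ) * σ, hmemV, hmemI⟩) =
      T.toTopRep.ρ (σ⁻¹ * (g : absoluteGaloisGroup ℚ) * σ) (w y) - w y := key
  rw [hgy, harg, key', map_sub, subgroupRep_ρ_apply, ← ρ_mul_apply, ← ρ_mul_apply, ← hσ]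
  have hprod : σ * (σ⁻¹ * (g : absoluteGaloisGroup ℚ) * σ) = (g : absoluteGaloisGroup ℚ) * σ := by
    group
  rw [hprod]

end CoresPlace

/-! ## §2 Above some layer every prime over `v ≠ p` is inert in a cyclotomic `ℤ_p`-extension:
Frobenius generators of `Γ_{n'}/Γ_{n'+k}` -/

section Generator

variable {p : ℕ} [Fact p.Prime] (κ : ZpExtension ℚ p)

/-- **Frobenius generators of the layers.**  For the cyclotomic `ℤ_p`-extension `κ` and a prime
`v ≠ p` there is a layer `n₀` such that for all `n' ≥ n₀`, all `k` and every `𝔓 ∣ v`, some element `φ`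
of the decomposition group of `𝔓` (`φ • 𝔓 = 𝔓`) lies in `Γ_{n'} = Gal(ℚ̄/ℚ_{n'})` and its class
GENERATES `Γ_{n'}/Γ_{n'+k}` (above `ℚ_{n₀}` every prime over `v` is inert in `ℚ_∞`): `κ` takes ONE
value `a ≠ 0` on all arithmetic Frobenius elements over `v` (`χ_p(Frob) = N v`,
`GaloisRep.cyclotomicCharacter_apply_of_isArithFrobAt`, has infinite order, and `ker κ = χ_p⁻¹(torsion)`),
`n₀ = v_p(a)`, `φ = Frob ^ (p ^ (n' − n₀))`. [cite: Washington1997, Prop. 13.2] [cite: SerreAbelianLadic1968, Ch. I §1.2] -/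
theorem exists_generator (hκ : κ.IsCyclotomic) {v : HeightOneSpectrum (𝓞 ℚ)}
    (hv : (p : 𝓞 ℚ) ∉ v.asIdeal) {𝔓₀ : Ideal (absIntegers (𝓞 ℚ) ℚ)} (h𝔓₀ : 𝔓₀ ∈ v.primesAbove) :
    ∃ n₀ : ℕ, ∀ 𝔓 ∈ v.primesAbove, ∀ n', n₀ ≤ n' → ∀ k : ℕ,
      ∃ φ : absoluteGaloisGroup ℚ, φ • 𝔓 = 𝔓 ∧ φ ∈ κ.layerSubgroup n' ∧
        ∀ u ∈ κ.layerSubgroup n', ∃ i : ℕ, (φ ^ i)⁻¹ * u ∈ κ.layerSubgroup (n' + k) := by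
  classical
  have hp : p.Prime := Fact.out
  obtain ⟨σ₀, hσ₀⟩ :=
    HeightOneSpectrum.exists_isArithFrobAt_of_mem_primesAbove_holds (K := ℚ) (v := v) h𝔓₀
  -- `ker κ = χ_p⁻¹(torsion)`
  have hker : ∀ τ : absoluteGaloisGroup ℚ,
      τ ∈ κ.kerSubgroup ↔ IsOfFinOrder (GaloisRep.cyclotomicCharacter ℚ p τ) := by
    intro τ
    rw [hκ, Subgroup.mem_comap, CommGroup.mem_torsion]
    rfl
  set a : ℤ_[p] := (κ σ₀).toAdd with ha
  have ha0 : a ≠ 0 := by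
    intro h0
    have h1 : κ σ₀ = 1 := by
      rw [← ofAdd_toAdd (κ σ₀)]
      change Multiplicative.ofAdd a = 1
      rw [h0]
      rfl
    exact GaloisRep.cyclotomicCharacter_frob_not_isOfFinOrder hv h𝔓₀ hσ₀
      ((hker σ₀).mp (ZpExtension.mem_kerSubgroup.mpr h1))
  refine ⟨a.valuation, fun 𝔓 h𝔓 n' hn' k => ?_⟩
  obtain ⟨σ, hσ⟩ :=
    HeightOneSpectrum.exists_isArithFrobAt_of_mem_primesAbove_holds (K := ℚ) (v := v) h𝔓
  -- `κ σ = κ σ₀`: both Frobenius elements have `χ_p = N v`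
  have hκσ : (κ σ).toAdd = a := by
    have hχ : GaloisRep.cyclotomicCharacter ℚ p σ = GaloisRep.cyclotomicCharacter ℚ p σ₀ := by
      apply Units.ext
      rw [GaloisRep.cyclotomicCharacter_apply_of_isArithFrobAt hv h𝔓 hσ,
        GaloisRep.cyclotomicCharacter_apply_of_isArithFrobAt hv h𝔓₀ hσ₀]
    have hmem : σ₀⁻¹ * σ ∈ κ.kerSubgroup := by
      rw [hker, map_mul, map_inv, hχ, inv_mul_cancel]
      exact IsOfFinOrder.one
    rw [ZpExtension.mem_kerSubgroup, map_mul, map_inv, inv_mul_eq_one] at hmem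
    rw [ha, hmem]
  -- the unit part of `a`
  set uu : ℤ_[p]ˣ := PadicInt.unitCoeff ha0 with huu
  have hau : a = (uu : ℤ_[p]) * (p : ℤ_[p]) ^ a.valuation := PadicInt.unitCoeff_spec ha0
  set N := n' - a.valuation with hN
  have hφval : (κ (σ ^ p ^ N)).toAdd = (uu : ℤ_[p]) * (p : ℤ_[p]) ^ n' := by
    rw [map_pow, toAdd_pow, hκσ, nsmul_eq_mul, Nat.cast_pow, hau, hN, mul_comm, mul_assoc, ← pow_add,
      Nat.add_sub_cancel' hn']
  haveI : 𝔓.IsPrime := h𝔓.1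
  refine ⟨σ ^ p ^ N, ?_, ?_, ?_⟩
  · -- `σ ^ p ^ N` lies in the decomposition group of `𝔓`
    have h1 : σ ^ p ^ N ∈ MulAction.stabilizer (absoluteGaloisGroup ℚ) 𝔓 :=
      Subgroup.pow_mem _ hσ.mem_stabilizer _
    exact MulAction.mem_stabilizer_iff.mp h1
  · rw [ZpExtension.mem_layerSubgroup, hφval]
    exact Dvd.intro_left _ rfl
  · intro u hu
    rw [ZpExtension.mem_layerSubgroup] at hu
    obtain ⟨b, hb⟩ := hu
    haveI : NeZero (p ^ k) := ⟨pow_ne_zero _ hp.ne_zero⟩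
    set i : ℕ := (PadicInt.toZModPow k (b * ((uu⁻¹ : ℤ_[p]ˣ) : ℤ_[p]))).val with hi
    refine ⟨i, ?_⟩
    -- `p ^ k ∣ b - i • uu`
    have hdiv : (p : ℤ_[p]) ^ k ∣ b - (i : ℤ_[p]) * (uu : ℤ_[p]) := by
      have hmem : (i : ℤ_[p]) - b * ((uu⁻¹ : ℤ_[p]ˣ) : ℤ_[p]) ∈ RingHom.ker (PadicInt.toZModPow k) := by
        rw [RingHom.mem_ker, map_sub, map_natCast, hi, ZMod.natCast_zmod_val, sub_self]
      rw [PadicInt.ker_toZModPow, Ideal.mem_span_singleton] at hmem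
      have h2 := Dvd.dvd.mul_left hmem (uu : ℤ_[p])
      have h3 : (uu : ℤ_[p]) * ((i : ℤ_[p]) - b * ((uu⁻¹ : ℤ_[p]ˣ) : ℤ_[p])) =
          -(b - (i : ℤ_[p]) * (uu : ℤ_[p])) := by
        rw [mul_sub, ← mul_assoc, mul_comm (uu : ℤ_[p]) b, mul_assoc, Units.mul_inv, mul_one]
        ring
      rw [h3] at h2
      exact (dvd_neg.mp h2)
    rw [ZpExtension.mem_layerSubgroup, map_mul, map_inv, map_pow, toAdd_mul, toAdd_inv, toAdd_pow,
      hφval, hb, nsmul_eq_mul]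
    have h4 : -((i : ℤ_[p]) * ((uu : ℤ_[p]) * (p : ℤ_[p]) ^ n')) + (p : ℤ_[p]) ^ n' * b =
        (p : ℤ_[p]) ^ n' * (b - (i : ℤ_[p]) * (uu : ℤ_[p])) := by ring
    rw [h4, pow_add]
    exact mul_dvd_mul_left _ hdiv

end Generator

/-! ## §3 Iterated norm compatibility along the layers -/

section Layers

variable (W : WeierstrassCurve ℚ) [W.IsElliptic] (p : ℕ) [Fact p.Prime]
  [ContinuousSMul ℤ_[p] (W.tateModule p)]

omit [W.IsElliptic] [ContinuousSMul ℤ_[p] (W.tateModule p)] in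
/-- The layers `Γ_n` of a `ℤ_p`-extension have finite index in `Γ_ℚ` (open subgroups of a compact
group). [cite: Washington1997, §13.1] -/
theorem finiteIndex_layerSubgroup (κ : ZpExtension ℚ p) (n : ℕ) : (κ.layerSubgroup n).FiniteIndex :=
  finiteIndex_of_isOpen_of_compactSpace _ (κ.isOpen_layerSubgroup n)

/-- **Iterated norm compatibility**: `z_n = cor_{Γ_{n+d+1} → Γ_n} z_{n+d+1}` for a norm-compatible
family (`layerCores`, transitivity of corestriction `coresLe_comp`).
[cite: Kato2004Asterisque, §12.2 (p. 220)] [cite: NeukirchSchmidtWingberg2008, Prop. 1.5.3] -/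
theorem eq_coresLe_add_succ (κ : ZpExtension ℚ p) (z : ∀ n : ℕ, H1 (tateRep W p) (κ.layerSubgroup n))
    (hz : ∀ n, layerCores (tateRep W p) κ n (z (n + 1)) = z n) (n : ℕ) :
    ∀ (d : ℕ) [Fintype (κ.layerSubgroup n ⧸ (κ.layerSubgroup (n + d + 1)).subgroupOf (κ.layerSubgroup n))],
      z n = coresLe (tateRep W p).toTopRep
        (κ.layerSubgroup_antitone (Nat.le_add_right n (d + 1)) :
          κ.layerSubgroup (n + d + 1) ≤ κ.layerSubgroup n)
        (κ.isOpen_layerSubgroup (n + d + 1)) (z (n + d + 1))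
  | 0, inst => by
      haveI := finiteIndex_layerSubgroup p κ (n + 0 + 1)
      have e : inst = Fintype.ofFinite _ := Subsingleton.elim _ _
      subst e
      rw [← hz n]
      unfold layerCores
      congr 1
  | d + 1, inst => by
      haveI := finiteIndex_layerSubgroup p κ (n + d + 1)
      haveI := finiteIndex_layerSubgroup p κ (n + d + 1 + 1)
      letI i1 : Fintype (κ.layerSubgroup n ⧸ (κ.layerSubgroup (n + d + 1)).subgroupOf (κ.layerSubgroup n)) :=
        Fintype.ofFinite _
      letI i2 : Fintype (κ.layerSubgroup (n + d + 1) ⧸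
          (κ.layerSubgroup (n + d + 1 + 1)).subgroupOf (κ.layerSubgroup (n + d + 1))) :=
        Fintype.ofFinite _
      have ih := eq_coresLe_add_succ κ z hz n d
      have hstep : z (n + d + 1) = coresLe (tateRep W p).toTopRep
          (κ.layerSubgroup_antitone (Nat.le_succ (n + d + 1)))
          (κ.isOpen_layerSubgroup (n + d + 1 + 1)) (z (n + d + 1 + 1)) := by
        rw [← hz (n + d + 1)]
        unfold layerCores
        congr 1
      rw [ih, hstep, ← LinearMap.comp_apply,
        coresLe_comp (tateRep W p).toTopRep (κ.layerSubgroup_antitone (Nat.le_succ (n + d + 1)))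
          (κ.layerSubgroup_antitone (Nat.le_add_right n (d + 1))) (κ.isOpen_layerSubgroup (n + d + 1 + 1))
          (κ.isOpen_layerSubgroup (n + d + 1))]
      rfl

end Layers

end Literature.NumberTheory.EllipticCurves.Kato2004.UniversalNorms

end
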